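import Literature.MathematicalPhysics.QuantumManyBody.BoseEinsteinCondensation
import Mathlib.Analysis.Calculus.ParametricIntervalIntegral
import Mathlib.Analysis.Calculus.ContDiff.FiniteDimension
import Mathlib.Analysis.InnerProductSpace.Calculus
import Mathlib.Analysis.SpecialFunctions.Trigonometric.Deriv
import Mathlib.MeasureTheory.Integral.DominatedConvergence
import Mathlib.MeasureTheory.Integral.IntervalIntegral.IntegrationByParts
import HarnessLib

/-!
# Route `BECTangentRigidity`, crux `RigidMomentumBound` (stmt-AtomisticToContinuum-13034):
# stub `stub_smearSqCalculus` — parametric-integral calculus of the rigidly smeared square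

For an admissible `Φ : TrialState N L₀`, a coordinate direction `a : Fin 3` and a smearing
length `τ > 0` put `𝟙ₐ := (eₐ, …, eₐ) : Config N` (every particle shifted in direction `a`),
`w(t) := τ⁻¹ sin²(πt/(2τ))` and

  `F(X) := ∫₀^{2τ} ‖Φ(X - t·𝟙ₐ)‖² w(t) dt`.

We prove: (i) `F` is `C¹`; (ii) its Fréchet derivative is obtained by differentiating under
the integral sign, `DF(X) Y = ∫₀^{2τ} D(‖Φ‖²)(X - t𝟙ₐ) Y · w(t) dt`; (iii) along the rigid
direction the derivative falls on the weight,
`DF(X) 𝟙ₐ = ∫₀^{2τ} ‖Φ(X - t𝟙ₐ)‖² w'(t) dt`, `w'(t) = (π/(2τ²)) sin(πt/τ)` (integration by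
parts in `t`; the boundary terms vanish because `w(0) = w(2τ) = 0`).

The calculus is done for a general `C¹` function `g` on a finite-dimensional real normed space
`P`, a direction `D : P` and a continuous weight `w` (differentiation under the integral sign:
Mathlib's `intervalIntegral.hasFDerivAt_integral_of_dominated_of_fderiv_le`, the dominating
constant coming from continuity of `(X, t) ↦ w(t) • Dg(X - tD)` on the compact
`closedBall X₀ 1 × [a, b]`; continuity of the derivative:
`intervalIntegral.continuous_parametric_intervalIntegral_of_continuous'`; integration by
parts: `intervalIntegral.integral_mul_deriv_eq_deriv_mul`), and then specialised to
`g = ‖Φ.ψ‖²` (`C¹` by `ContDiff.norm_sq`), `D = 𝟙ₐ`, `[a, b] = [0, 2τ]`.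

References: L. C. Evans, *Partial Differential Equations*, 2nd ed. (2010), App. C.4
(differentiation under the integral sign, mollification of translates); LSSY 2005, Ch. 2
(localisation of trial states by smooth cut-offs).
-/

noncomputable section

namespace Summit.AtomisticToContinuum.BoseEinsteinCondensation.Theorems.RigidMomentumBound

open MeasureTheory Filter intervalIntegral Set Metric Topology
open scoped ENNReal NNReal
open Literature.MathematicalPhysics.QuantumManyBody.BoseGas

section Parametric

variable {P : Type*} [NormedAddCommGroup P] [NormedSpace ℝ P]

/-- Chain rule for a weighted translate: `Y ↦ g(Y - tD) w(t)` has Fréchet derivative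
`w(t) • Dg(X - tD)` at `X`. [folklore] -/
theorem hasFDerivAt_translate_mul {g : P → ℝ} (hg : ContDiff ℝ 1 g) (D : P) (w : ℝ → ℝ)
    (t : ℝ) (X : P) :
    HasFDerivAt (fun Y : P => g (Y - t • D) * w t) (w t • fderiv ℝ g (X - t • D)) X := by
  have h1 : HasFDerivAt g (fderiv ℝ g (X - t • D)) (X - t • D) :=
    ((hg.differentiable one_ne_zero) _).hasFDerivAt
  have h2 : HasFDerivAt (fun Y : P => Y - t • D) (ContinuousLinearMap.id ℝ P) X :=
    (hasFDerivAt_id X).sub_const (t • D)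
  have h3 := (h1.comp X h2).mul_const (w t)
  simpa [Function.comp_def] using h3

/-- Chain rule along the flow: `s ↦ g(X - sD)` has derivative `-Dg(X - tD) D` at `t`.
[folklore] -/
theorem hasDerivAt_translate {g : P → ℝ} (hg : ContDiff ℝ 1 g) (D X : P) (t : ℝ) :
    HasDerivAt (fun s : ℝ => g (X - s • D)) (-(fderiv ℝ g (X - t • D) D)) t := by
  have h1 : HasFDerivAt g (fderiv ℝ g (X - t • D)) (X - t • D) :=
    ((hg.differentiable one_ne_zero) _).hasFDerivAt
  have h2 : HasDerivAt (fun s : ℝ => X - s • D) (-D) t := by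
    simpa using ((hasDerivAt_id t).smul_const D).const_sub X
  simpa [Function.comp_def] using h1.comp_hasDerivAt t h2

/-- Joint continuity of the derivative family `(X, t) ↦ w(t) • Dg(X - tD)`. [folklore] -/
theorem continuous_translate_fderiv_family {g : P → ℝ} (hg : ContDiff ℝ 1 g) {w : ℝ → ℝ}
    (hw : Continuous w) (D : P) :
    Continuous (fun q : P × ℝ => w q.2 • fderiv ℝ g (q.1 - q.2 • D)) :=
  (hw.comp continuous_snd).smul
    ((hg.continuous_fderiv one_ne_zero).comp
      (continuous_fst.sub (continuous_snd.smul continuous_const)))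

variable [FiniteDimensional ℝ P]

/-- **Differentiation under the integral sign** for `X ↦ ∫ₐᵇ g(X - tD) w(t) dt`, `g ∈ C¹`,
`w` continuous: the derivative at `X₀` is `∫ₐᵇ w(t) • Dg(X₀ - tD) dt` (Evans, App. C.4;
Mathlib's `intervalIntegral.hasFDerivAt_integral_of_dominated_of_fderiv_le` with the constant
bound given by continuity of the derivative family on the compact `closedBall X₀ 1 × [a, b]`).
[folklore] -/
theorem hasFDerivAt_translateIntegral {g : P → ℝ} (hg : ContDiff ℝ 1 g) {w : ℝ → ℝ}
    (hw : Continuous w) (D : P) (a b : ℝ) (X₀ : P) :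
    HasFDerivAt (fun X : P => ∫ t in a..b, g (X - t • D) * w t)
      (∫ t in a..b, w t • fderiv ℝ g (X₀ - t • D)) X₀ := by
  -- adapted from Literature/Analysis/FunctionSpaces/SmoothParametricIntegral.lean
  -- (`hasFDerivAt_parametric_intervalIntegral`)
  have hgc : Continuous g := hg.continuous
  have hF'c := continuous_translate_fderiv_family hg hw D
  obtain ⟨C, hC⟩ : ∃ C, ∀ q ∈ closedBall X₀ (1 : ℝ) ×ˢ uIcc a b,
      ‖w q.2 • fderiv ℝ g (q.1 - q.2 • D)‖ ≤ C :=
    ((isCompact_closedBall X₀ 1).prod isCompact_uIcc).exists_bound_of_continuousOn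
      hF'c.continuousOn
  have hFc : ∀ X : P, Continuous fun t : ℝ => g (X - t • D) * w t := fun X =>
    (hgc.comp (continuous_const.sub (continuous_id.smul continuous_const))).mul hw
  refine intervalIntegral.hasFDerivAt_integral_of_dominated_of_fderiv_le
    (F := fun X t => g (X - t • D) * w t) (F' := fun X t => w t • fderiv ℝ g (X - t • D))
    (bound := fun _ => C) (μ := volume) (ball_mem_nhds X₀ one_pos) ?_ ?_ ?_ ?_ ?_ ?_
  · exact Eventually.of_forall fun X => (hFc X).aestronglyMeasurable
  · exact (hFc X₀).intervalIntegrable _ _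
  · exact (hF'c.comp (continuous_const.prodMk continuous_id)).aestronglyMeasurable
  · refine Eventually.of_forall fun t ht X hX => hC (X, t) ⟨?_, ?_⟩
    · exact mem_closedBall.2 (le_of_lt (mem_ball.1 hX))
    · exact uIoc_subset_uIcc ht
  · exact intervalIntegrable_const
  · exact Eventually.of_forall fun t _ X _ => hasFDerivAt_translate_mul hg D w t X

/-- `X ↦ ∫ₐᵇ g(X - tD) w(t) dt` is `C¹` for `g ∈ C¹` and `w` continuous (differentiable by
`hasFDerivAt_translateIntegral`, with derivative `X ↦ ∫ₐᵇ w(t) • Dg(X - tD) dt` continuous by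
`intervalIntegral.continuous_parametric_intervalIntegral_of_continuous'`). [folklore] -/
theorem contDiff_translateIntegral {g : P → ℝ} (hg : ContDiff ℝ 1 g) {w : ℝ → ℝ}
    (hw : Continuous w) (D : P) (a b : ℝ) :
    ContDiff ℝ 1 (fun X : P => ∫ t in a..b, g (X - t • D) * w t) := by
  rw [contDiff_one_iff_fderiv]
  refine ⟨fun X => (hasFDerivAt_translateIntegral hg hw D a b X).differentiableAt, ?_⟩
  have hfd : fderiv ℝ (fun X : P => ∫ t in a..b, g (X - t • D) * w t) =
      fun X => ∫ t in a..b, w t • fderiv ℝ g (X - t • D) :=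
    funext fun X => (hasFDerivAt_translateIntegral hg hw D a b X).fderiv
  rw [hfd]
  exact intervalIntegral.continuous_parametric_intervalIntegral_of_continuous'
    (f := fun X t => w t • fderiv ℝ g (X - t • D)) (continuous_translate_fderiv_family hg hw D) a b

/-- The derivative of `X ↦ ∫ₐᵇ g(X - tD) w(t) dt` in the direction `Y` is
`∫ₐᵇ Dg(X - tD) Y · w(t) dt`. [folklore] -/
theorem fderiv_translateIntegral_apply {g : P → ℝ} (hg : ContDiff ℝ 1 g) {w : ℝ → ℝ}
    (hw : Continuous w) (D : P) (a b : ℝ) (X Y : P) :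
    fderiv ℝ (fun X : P => ∫ t in a..b, g (X - t • D) * w t) X Y =
      ∫ t in a..b, fderiv ℝ g (X - t • D) Y * w t := by
  rw [(hasFDerivAt_translateIntegral hg hw D a b X).fderiv]
  have hc : Continuous fun t : ℝ => w t • fderiv ℝ g (X - t • D) :=
    (continuous_translate_fderiv_family hg hw D).comp (continuous_const.prodMk continuous_id)
  rw [ContinuousLinearMap.intervalIntegral_apply (hc.intervalIntegrable _ _)]
  refine intervalIntegral.integral_congr fun t _ => ?_
  simp [mul_comm]

omit [FiniteDimensional ℝ P] in
/-- **Integration by parts along the rigid direction**: if `w(a) = w(b) = 0` and `w' ` is the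
(continuous) derivative of `w`, then `∫ₐᵇ Dg(X - tD) D · w(t) dt = ∫ₐᵇ g(X - tD) w'(t) dt`
(`d/dt g(X - tD) = -Dg(X - tD) D`, `intervalIntegral.integral_mul_deriv_eq_deriv_mul`).
[folklore] -/
theorem integral_fderiv_rigid_mul_eq {g : P → ℝ} (hg : ContDiff ℝ 1 g) (D X : P)
    {w w' : ℝ → ℝ} (hw : ∀ t, HasDerivAt w (w' t) t) (hw' : Continuous w') {a b : ℝ}
    (ha : w a = 0) (hb : w b = 0) :
    ∫ t in a..b, fderiv ℝ g (X - t • D) D * w t = ∫ t in a..b, g (X - t • D) * w' t := by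
  have hu : ∀ t ∈ uIcc a b,
      HasDerivAt (fun s : ℝ => g (X - s • D)) (-(fderiv ℝ g (X - t • D) D)) t :=
    fun t _ => hasDerivAt_translate hg D X t
  have hv : ∀ t ∈ uIcc a b, HasDerivAt w (w' t) t := fun t _ => hw t
  have hu'c : Continuous fun t : ℝ => -(fderiv ℝ g (X - t • D) D) :=
    (((hg.continuous_fderiv one_ne_zero).comp
      (continuous_const.sub (continuous_id.smul continuous_const))).clm_apply
        continuous_const).neg
  have hparts := intervalIntegral.integral_mul_deriv_eq_deriv_mul hu hv
    (hu'c.intervalIntegrable _ _) (hw'.intervalIntegrable _ _)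
  rw [hparts, ha, hb, mul_zero, mul_zero, sub_zero, zero_sub]
  simp only [neg_mul, intervalIntegral.integral_neg, neg_neg]

end Parametric

/-- The smearing weight `w(t) = τ⁻¹ sin²(πt/(2τ))` has derivative
`w'(t) = (π/(2τ²)) sin(πt/τ)` (chain rule and `2 sin cos = sin 2·`). [folklore] -/
theorem hasDerivAt_sinSqWeight (τ t : ℝ) (hτ : τ ≠ 0) :
    HasDerivAt (fun t : ℝ => τ⁻¹ * Real.sin (Real.pi * t / (2 * τ)) ^ 2)
      (Real.pi / (2 * τ ^ 2) * Real.sin (Real.pi * t / τ)) t := by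
  have h1 : HasDerivAt (fun t : ℝ => Real.pi * t / (2 * τ)) (Real.pi / (2 * τ)) t := by
    simpa using ((hasDerivAt_id t).const_mul Real.pi).div_const (2 * τ)
  have h2 : HasDerivAt (fun t : ℝ => Real.sin (Real.pi * t / (2 * τ)) ^ 2)
      (((2 : ℕ) : ℝ) * Real.sin (Real.pi * t / (2 * τ)) ^ (2 - 1) *
        (Real.cos (Real.pi * t / (2 * τ)) * (Real.pi / (2 * τ)))) t :=
    h1.sin.pow 2
  refine (h2.const_mul τ⁻¹).congr_deriv ?_
  have hθ : Real.pi * t / τ = 2 * (Real.pi * t / (2 * τ)) := by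
    field_simp
  rw [hθ, Real.sin_two_mul]
  push_cast
  field_simp

/-- **`stub_smearSqCalculus`** (parametric-integral calculus of the rigidly smeared square).
For an admissible `Φ`, a direction `a` and `τ > 0`, the smeared square
`F(X) = ∫₀^{2τ} ‖Φ(X - t·𝟙ₐ)‖² w(t) dt` (`𝟙ₐ = (eₐ,…,eₐ)`, `w(t) = τ⁻¹ sin²(πt/(2τ))`) is `C¹`;
its derivative is obtained by differentiating under the integral sign; and its derivative
along the rigid direction `𝟙ₐ` is `∫₀^{2τ} ‖Φ(X - t·𝟙ₐ)‖² w'(t) dt`, `w'(t) = (π/(2τ²)) sin(πt/τ)`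
(integration by parts in `t`, using `w(0) = w(2τ) = 0`). [folklore] -/
theorem stub_smearSqCalculus :
    ∀ {N : ℕ} {L₀ : ℝ} (Φ : TrialState N L₀) (a : Fin 3) (τ : ℝ), 0 < τ →
      ContDiff ℝ 1 (fun X : Config N => ∫ t in (0 : ℝ)..(2 * τ),
          ‖Φ.ψ (X - t • (fun _ : Fin N => EuclideanSpace.single a (1 : ℝ)))‖ ^ 2 *
            (τ⁻¹ * Real.sin (Real.pi * t / (2 * τ)) ^ 2)) ∧
      (∀ X Y : Config N,
        fderiv ℝ (fun X : Config N => ∫ t in (0 : ℝ)..(2 * τ),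
            ‖Φ.ψ (X - t • (fun _ : Fin N => EuclideanSpace.single a (1 : ℝ)))‖ ^ 2 *
              (τ⁻¹ * Real.sin (Real.pi * t / (2 * τ)) ^ 2)) X Y =
          ∫ t in (0 : ℝ)..(2 * τ),
            fderiv ℝ (fun Z : Config N => ‖Φ.ψ Z‖ ^ 2)
                (X - t • (fun _ : Fin N => EuclideanSpace.single a (1 : ℝ))) Y *
              (τ⁻¹ * Real.sin (Real.pi * t / (2 * τ)) ^ 2)) ∧
      (∀ X : Config N,
        fderiv ℝ (fun X : Config N => ∫ t in (0 : ℝ)..(2 * τ),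
            ‖Φ.ψ (X - t • (fun _ : Fin N => EuclideanSpace.single a (1 : ℝ)))‖ ^ 2 *
              (τ⁻¹ * Real.sin (Real.pi * t / (2 * τ)) ^ 2)) X
            (fun _ : Fin N => EuclideanSpace.single a (1 : ℝ)) =
          ∫ t in (0 : ℝ)..(2 * τ),
            ‖Φ.ψ (X - t • (fun _ : Fin N => EuclideanSpace.single a (1 : ℝ)))‖ ^ 2 *
              (Real.pi / (2 * τ ^ 2) * Real.sin (Real.pi * t / τ))) := by
  intro N L₀ Φ a τ hτ
  have hg : ContDiff ℝ 1 (fun Z : Config N => ‖Φ.ψ Z‖ ^ 2) := Φ.contDiff.norm_sq ℂ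
  have hw : Continuous (fun t : ℝ => τ⁻¹ * Real.sin (Real.pi * t / (2 * τ)) ^ 2) := by
    fun_prop
  have hw' : Continuous (fun t : ℝ => Real.pi / (2 * τ ^ 2) * Real.sin (Real.pi * t / τ)) := by
    fun_prop
  have h0 : τ⁻¹ * Real.sin (Real.pi * 0 / (2 * τ)) ^ 2 = 0 := by simp
  have h2τ : τ⁻¹ * Real.sin (Real.pi * (2 * τ) / (2 * τ)) ^ 2 = 0 := by
    rw [mul_div_cancel_right₀ Real.pi (by positivity : (2 * τ : ℝ) ≠ 0), Real.sin_pi]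
    simp
  refine ⟨contDiff_translateIntegral hg hw (fun _ : Fin N => EuclideanSpace.single a (1 : ℝ))
      0 (2 * τ),
    fun X Y => fderiv_translateIntegral_apply hg hw
      (fun _ : Fin N => EuclideanSpace.single a (1 : ℝ)) 0 (2 * τ) X Y,
    fun X => ?_⟩
  refine (fderiv_translateIntegral_apply hg hw
    (fun _ : Fin N => EuclideanSpace.single a (1 : ℝ)) 0 (2 * τ) X _).trans ?_
  exact integral_fderiv_rigid_mul_eq hg _ X (w' := fun t : ℝ =>
    Real.pi / (2 * τ ^ 2) * Real.sin (Real.pi * t / τ))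
    (fun t => hasDerivAt_sinSqWeight τ t hτ.ne') hw' h0 h2τ

end Summit.AtomisticToContinuum.BoseEinsteinCondensation.Theorems.RigidMomentumBound

end
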